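import Summits.HodgeConjecture.HodgeConjecture.Theorems.VHCAbelianSchemesRoadWeilLineAnchorsOver
import Summits.HodgeConjecture.CorCM.AndrePolarizedFormHolds
import Literature.AlgebraicGeometry.HodgeTheory.KodairaEmbeddingHyperplaneClass
import HarnessLib

/-!
# Road b02 (`VHCAbelianSchemesRoad`) × the André column — KODAIRA GLUE FOR THE PRESCRIBED-FIBRE LINE FACTS: Lemme 6.3.2 discharged by the CorCM kernel theorem,
# so `HC_CM` (and `HC_AV` with `HC_CM` idle) over anchors OF OUR CHOICE need only Lemme 6.3.3 ALONE (prescribed-fibre line form), Kodaira, the door and the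
# per-cell one-class nodes (route-free)

research route, not a corollary; conditional on HC_CM plus one named minimal statement.

ROUTE-FREE. PART AE-II. The pattern of `VHCAbelianSchemesRoadWeilLineKodairaGlue` (gen 61) over a prescribed anchor variety `Y₀`: André 1992 (= Lemme 6.3.2) is a
theorem of the tree (`CorCM.andre1992_hodgeClasses_cmType_mem_span_pullback_polarizedHyperbolicWeilClassesCM_holds`: a rational `(p,p)` class on a CM abelian variety
lies in the span of pull-backs of rational Weil classes of POLARIZED hyperbolic split CM-field data), Kodaira's embedding theorem (named fact
`Kodaira1954_rationalKaehlerClass_eq_hyperplaneClass`) turns the polarization class into a hyperplane class `e^*a` (André's `(*)` in the tree's typing), and Lemme 6.3.3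
ALONE in prescribed-fibre line form (`andre1996_splitWeilClasses_weilLinePencil_over`, `n = 1`) anchors each datum at `Y₀`:

* §1 `andre1996_cmHodgeClasses_weilLinePencils_over ⟸ Kodaira ∧ andre1996_splitWeilClasses_weilLinePencil_over`;
* §2 `HC_CM` and `HC_AV` (with `HC_CM` idle) over a family of anchors `Y : ℕ → AbelianVariety ℂ` (`0 < dim (Y p) ∣ p`, `dim (Y p) ≤ 3`) from Kodaira ∧ ONE André
  fact ∧ the door ∧ (CM-algebraic carriers) ∧ the per-cell guarded nodes over `Y p`.

HONEST: the carrier nodes are OPEN, NOT implied by the Hodge conjecture; PART AE (evidence on the crux item) excludes split ∕ union designs; Kodaira's theorem and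
Lemme 6.3.3 (prescribed-fibre form, faithful to André's proof) are THEOREMS in print entering BY NAME; Lemme 6.3.1 and the door are the road's binders. Nothing here
says any carrier, door, Weil class, `HC_CM`, `HC_AV` or HC holds. References: [cite: Andre1996Motifs, §6.3 a)–c), Lemmes 6.3.1–6.3.3 and proof of 6.3.3 (pp. 31–33)]
[cite: Andre1992HodgeCM, Théorème] [cite: Deligne1982HodgeCycles, §4 Thm. 4.8] [cite: Huybrechts2005, Prop. 5.3.1, Cor. 5.3.3 (Kodaira embedding)]
[cite: MoonenZarhin1999LowDim, Thm. 0.1 (4)] [cite: MoonenZarhin1998WeilClasses, §1] [cite: Bloch1972Semiregularity, Remark (7.5)] [cite: BuchweitzFlenner2003, §5 Thm. 5.1].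
-/

noncomputable section

open CategoryTheory CategoryTheory.Limits AlgebraicGeometry Topology

namespace Summit.HodgeConjecture.HodgeConjecture.Ring2.SemiregularRepresentatives

-- the cell's namespace repeats the summit name (`Summit.HodgeConjecture.HodgeConjecture…`), as in every `Ring2*` file
set_option linter.dupNamespace false

open Literature.AlgebraicGeometry Literature.AlgebraicGeometry.Motives
open Literature.AlgebraicGeometry.HodgeTheory
open Literature.AlgebraicGeometry.Deligne1982
open Literature.AlgebraicGeometry.VanGeemen1994 (pullbackOne)
open Literature.AlgebraicTopology.SingularHomology
open Literature.AlgebraicGeometry.Milne1999 (IsOfCMType CMHodgeHypothesisAt)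
open Literature.AlgebraicGeometry.Andre1996 (andre1996_cmAnchoredPencil andre1996_splitWeilClasses_weilLinePencil_over andre1996_cmHodgeClasses_weilLinePencils_over)
open Summit.HodgeConjecture.CorCM.AndreSplit (andre1992_hodgeClasses_cmType_mem_span_pullback_polarizedHyperbolicWeilClassesCM_holds)
open Summit.Ventures.HSemireg (ObjClass LocalVariationalHodgeFor)
open Summit.HodgeConjecture.HodgeConjecture.Ring2.AbelianAll (OneTensorWeilHodgeClassCarriersAt)

/-! ## §1 The prescribed-fibre CM line fact from Kodaira and Lemme 6.3.3 alone (prescribed-fibre line form) -/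

/-- **`andre1996_cmHodgeClasses_weilLinePencils_over ⟸ Kodaira ∧ andre1996_splitWeilClasses_weilLinePencil_over`** — Lemme 6.3.2 supplied by CorCM's kernel theorem
(André 1992): a rational `(p,p)` class on a CM abelian variety `B`, `p > 1`, lies in the span of pull-backs `g^*(w)` of rational Weil classes of POLARIZED hyperbolic split
CM-field data; Kodaira makes the polarization class a hyperplane class `e^*a`; Lemme 6.3.3 alone (prescribed-fibre line form, `n = 1`) anchors `(B', η, w)` at the
prescribed `Y₀` (`0 < dim Y₀ ∣ p`, Hodge classes on the varieties isogenous to its powers algebraic); the span is monotone.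
[cite: Andre1996Motifs, §6.3 Lemme 6.3.2 (p. 32), Lemme 6.3.3 and proof (p. 33)] [cite: Andre1992HodgeCM, Théorème] [cite: Deligne1982HodgeCycles, §4 Thm. 4.8 (a)–(b)]
[cite: Huybrechts2005, Prop. 5.3.1, Cor. 5.3.3] -/
theorem andre1996_cmHodgeClasses_weilLinePencils_over_of_kodaira_of_splitWeilLinePencil_over (hK : Kodaira1954_rationalKaehlerClass_eq_hyperplaneClass)
    (h633 : andre1996_splitWeilClasses_weilLinePencil_over) : andre1996_cmHodgeClasses_weilLinePencils_over := by
  intro Y₀ hY₀ hHC B _ hCM p hp hdvd c hc hpp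
  obtain ⟨R, e₀, -, hspan⟩ := andre1992_hodgeClasses_cmType_mem_span_pullback_polarizedHyperbolicWeilClassesCM_holds B hCM
  refine Submodule.span_mono ?_ (hspan p (by omega) c hc hpp)
  rintro _ ⟨B', g, η, w, -, hP, hw, hwQ, -, rfl⟩
  -- Kodaira: the polarization class of the datum is the hyperplane class of a projective embedding
  obtain ⟨hW, h, hpol, hKm, hros, -, hhyp⟩ := hP
  have hd : 0 < B'.dim := by have := hW.two_le_dim; omega
  obtain ⟨e, a, ha, ha0, hea⟩ := hK (AbelianVariety.isSmoothProjective_holds (A := B')) hd h hpol.isRationalClass hKm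
  rw [← hea] at hros hhyp
  -- Lemme 6.3.3 alone, prescribed-fibre line form, anchors `(B', η, w)` at `Y₀`
  obtain ⟨𝒳, S, f, hf⟩ := h633 Y₀ hY₀ hHC R e₀ p hp hdvd 1 (fun _ => B') (fun _ => η) (fun _ => e) (fun _ => a) (fun _ => w)
    (fun _ => hW) (fun _ => ⟨ha, ha0⟩) (fun _ => hros) (fun _ => hhyp) (fun _ => hw) (fun _ => hwQ)
  exact ⟨B', g, η, R, e₀, e, a, w, 𝒳, S, f, hW, ha, ha0, hros, hhyp, hw, hwQ, hf 0, rfl⟩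

/-! ## §2 `HC_CM` and `HC_AV` (with `HC_CM` idle) over anchors of our choice from Kodaira, ONE André fact, the door and the per-cell nodes -/

variable {𝒪 : ObjClass}

/-- **`HC_CM` FROM KODAIRA, LEMME 6.3.3 ALONE (prescribed-fibre line form), THE DOOR AND ONE CARRIED CLASS PER TENSOR STRUCTURE OVER A FAMILY OF ANCHORS**
(`0 < dim (Y p) ∣ p`, powers satisfying HC): `CMHodgeHypothesisAt B` for every `B`. [cite: Andre1996Motifs, §6.3 (pp. 32–33)] [cite: Andre1992HodgeCM, Théorème]
[cite: MoonenZarhin1998WeilClasses, §1] [cite: Milne1999, §7 p. 72] -/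
theorem cmHodgeHypothesisAt_of_kodaira_of_splitWeilLinePencilOver_of_door_of_family (hK : Kodaira1954_rationalKaehlerClass_eq_hyperplaneClass)
    (h633 : andre1996_splitWeilClasses_weilLinePencil_over) (hT : LocalVariationalHodgeFor 𝒪) (Y : ℕ → AbelianVariety ℂ)
    (hY : ∀ p, 0 < (Y p).dim ∧ (Y p).dim ∣ p)
    (hHC : ∀ (p : ℕ) (X : AbelianVariety ℂ) (N : ℕ), X.IsIsogenous ((Y p).powSucc N) → HodgeConjectureFor X.dim X.X)
    (hone : ∀ n p : ℕ, 2 ≤ p → p + 2 ≤ n → OneTensorWeilHodgeClassCarriersAt 𝒪 (Y p) n p) (B : AbelianVariety ℂ) : CMHodgeHypothesisAt B :=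
  cmHodgeHypothesisAt_of_weilLinePencilsOver_of_door_of_family
    (andre1996_cmHodgeClasses_weilLinePencils_over_of_kodaira_of_splitWeilLinePencil_over hK h633) hT Y hY hHC hone B

/-- **`HC_CM` from Kodaira ∧ ONE André fact ∧ the door ∧ per-cell nodes over anchors with `dim (Y p) ≤ 3` — UNCONDITIONAL anchor supply** (Moonen–Zarhin).
[cite: MoonenZarhin1999LowDim, Thm. 0.1 (4)] [cite: Andre1996Motifs, §6.3 (pp. 32–33)] [cite: Andre1992HodgeCM, Théorème] -/
theorem cmHodgeHypothesisAt_of_kodaira_of_splitWeilLinePencilOver_of_door_of_family_of_dim_le_three (hK : Kodaira1954_rationalKaehlerClass_eq_hyperplaneClass)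
    (h633 : andre1996_splitWeilClasses_weilLinePencil_over) (hT : LocalVariationalHodgeFor 𝒪) (Y : ℕ → AbelianVariety ℂ)
    (hY : ∀ p, 0 < (Y p).dim ∧ (Y p).dim ∣ p ∧ (Y p).dim ≤ 3) (hone : ∀ n p : ℕ, 2 ≤ p → p + 2 ≤ n → OneTensorWeilHodgeClassCarriersAt 𝒪 (Y p) n p)
    (B : AbelianVariety ℂ) : CMHodgeHypothesisAt B :=
  cmHodgeHypothesisAt_of_kodaira_of_splitWeilLinePencilOver_of_door_of_family hK h633 hT Y (fun p ↦ ⟨(hY p).1, (hY p).2.1⟩)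
    (fun p ↦ hodgeConjectureFor_of_isIsogenous_powSucc_of_dim_le_three (hY p).1 (hY p).2.2) hone B

/-- **`HC_AV` with `HC_CM` idle, from Kodaira, Lemme 6.3.1, Lemme 6.3.3 alone (prescribed-fibre line form), the door, CM-algebraic carriers and one carried Weil class per tensor
structure over a family of anchors.** [cite: Andre1996Motifs, §6.3 Lemmes 6.3.1–6.3.3 (pp. 31–33)] [cite: Andre1992HodgeCM, Théorème] [cite: Bloch1972Semiregularity, Remark (7.5)] -/
theorem forall_hodgeConjectureFor_of_kodaira_of_andre1996_of_splitWeilLinePencilOver_of_door_of_cmAlgebraic_of_family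
    (hK : Kodaira1954_rationalKaehlerClass_eq_hyperplaneClass) (h₂₁ : andre1996_cmAnchoredPencil) (h633 : andre1996_splitWeilClasses_weilLinePencil_over)
    (hT : LocalVariationalHodgeFor 𝒪)
    (hcm : ∀ n p : ℕ, 2 ≤ p → 2 * p + 4 ≤ n → AnchoredCarrierAt 𝒪 n p
      (fun X θ ↦ (∃ A₀ : AbelianVariety ℂ, A₀.dim = n ∧ IsOfCMType A₀ ∧ Nonempty (A₀.X ≅ X)) ∧ IsPolarizationClass n X θ)
      (fun X _ ↦ (algebraicClasses X p : Set (complexBetti X (2 * p)))))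
    (Y : ℕ → AbelianVariety ℂ) (hY : ∀ p, 0 < (Y p).dim ∧ (Y p).dim ∣ p)
    (hHC : ∀ (p : ℕ) (X : AbelianVariety ℂ) (N : ℕ), X.IsIsogenous ((Y p).powSucc N) → HodgeConjectureFor X.dim X.X)
    (hone : ∀ n p : ℕ, 2 ≤ p → p + 2 ≤ n → OneTensorWeilHodgeClassCarriersAt 𝒪 (Y p) n p) :
    ∀ A : AbelianVariety ℂ, HodgeConjectureFor A.dim A.X :=
  forall_hodgeConjectureFor_of_andre1996_of_weilLinePencilsOver_of_door_of_cmAlgebraic_of_family h₂₁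
    (andre1996_cmHodgeClasses_weilLinePencils_over_of_kodaira_of_splitWeilLinePencil_over hK h633) hT hcm Y hY hHC hone

end Summit.HodgeConjecture.HodgeConjecture.Ring2.SemiregularRepresentatives

end
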